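import Literature.AlgebraicGeometry.HodgeTheory.AtiyahClassTraceReal
import Literature.AlgebraicGeometry.Modules.TensorUnitors
import Literature.AlgebraicGeometry.Deformation.VectorBundleLifting
import HarnessLib

/-!
# The semiregularity components on the deformation-theoretic obstruction groups

Glue between two real carriers in the tree: the obstruction groups
`obstructionGroup n E I = Extⁿ_{𝒪_X}(E, E ⊗_{𝒪_X} I)` of `Deformation/VectorBundleLifting.lean` (where the
obstruction classes to lifting a vector bundle across a square-zero thickening with ideal `I` live,
The Stacks project Tag 08VR) and the source `Ext²_{𝒪_X}(E, E)` of the real semiregularity components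
`sigmaZero`, `sigmaOne` of `HodgeTheory/AtiyahClassTraceReal.lean` ([BuchweitzFlenner2003] Def. 4.1).
For coefficients `I = 𝒪_X` (the case of a `W_n`-thickening, `pⁿ𝒪/pⁿ⁺¹𝒪 ≅ 𝒪_{X₁}`, after
`obstructionGroupMapIso`), `Modules/TensorUnitors.extTensorUnitRightEquiv : Ext²(E, E ⊗ 𝒪_X) ≃+ Ext²(E, E)`
identifies the two, and this file transports `σ₀`, `σ₁` and the semiregularity predicates:

* `sigmaZeroObstruction hE : obstructionGroup 2 E 𝒪_X → H²(X, 𝒪_X)`,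
  `sigmaOneObstruction hE : obstructionGroup 2 E 𝒪_X → H³(X, Ω¹_{X/S})`;
* `isZeroOneSemiregular_iff_obstruction` — `E` is `{0,1}`-semiregular iff `(σ₀, σ₁)` is injective on
  the obstruction group `Ext²(E, E ⊗ 𝒪_X)` (and the `σ₀`-only / `σ₁`-only versions).

So a route can state "`E₁` semiregular ⇒ an obstruction class `o ∈ Ext²(E₁, E₁ ⊗ I)` with
`σ(o) = 0` vanishes" as a closed statement on real carriers (crux `PadicPridhamSemiregularity` of
`HodgeConjecture/PadicSemiregularLift`). Nothing here is specific to `p`-adic geometry.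

## References

* [BuchweitzFlenner2003] R.-O. Buchweitz, H. Flenner, Compositio Math. 137 (2003), §1, Def. 4.1.
* [StacksProject] The Stacks project, Tag 08VR (obstruction in `Ext²(E, E ⊗ I)`), Tag 01CA.
-/

noncomputable section

open CategoryTheory CategoryTheory.Abelian AlgebraicGeometry Opposite TopologicalSpace Limits

namespace Literature.AlgebraicGeometry.HodgeTheory

open Literature.AlgebraicGeometry.Modules Literature.AlgebraicGeometry.Motives
  Literature.AlgebraicGeometry.Deformation

universe u

variable {S : Type u} [CommRing S] {X : Over (Spec (CommRingCat.of S))} {E : X.left.Modules}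
  (hE : IsFiniteLocallyFree E)

/-- `Ext²(E, E ⊗ 𝒪_X) ≃+ Ext²(E, E)`: the obstruction group with trivial coefficients IS the source
of the semiregularity map (transport along `E ⊗ 𝒪_X ≅ E`). [cite: StacksProject, Tag 01CA] -/
abbrev obstructionGroupUnitEquiv (E : X.left.Modules) (n : ℕ) :
    obstructionGroup n E (unitModule X.left) ≃+ Ext E E n :=
  extTensorUnitRightEquiv E E n

/-- **`σ₀` on the obstruction group** `Ext²(E, E ⊗ 𝒪_X) → H²(X, 𝒪_X)`.
[cite: BuchweitzFlenner2003, §1 (σ_0) and Def. 4.1] -/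
def sigmaZeroObstruction :
    obstructionGroup 2 E (unitModule X.left) →+ structureSheafCohomology X.left 2 :=
  (sigmaZero hE).comp (obstructionGroupUnitEquiv E 2).toAddMonoidHom

/-- **`σ₁` on the obstruction group** `Ext²(E, E ⊗ 𝒪_X) → H³(X, Ω¹_{X/S})`.
[cite: BuchweitzFlenner2003, Def. 4.1] -/
def sigmaOneObstruction :
    obstructionGroup 2 E (unitModule X.left) →+ hodgeCohomologyOne X 3 :=
  (sigmaOne hE).comp (obstructionGroupUnitEquiv E 2).toAddMonoidHom

/-- Unfolding `sigmaZeroObstruction`. [folklore] -/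
@[simp]
lemma sigmaZeroObstruction_apply (o : obstructionGroup 2 E (unitModule X.left)) :
    sigmaZeroObstruction hE o = sigmaZero hE (obstructionGroupUnitEquiv E 2 o) := rfl

/-- Unfolding `sigmaOneObstruction`. [folklore] -/
@[simp]
lemma sigmaOneObstruction_apply (o : obstructionGroup 2 E (unitModule X.left)) :
    sigmaOneObstruction hE o = sigmaOne hE (obstructionGroupUnitEquiv E 2 o) := rfl

/-- **`{0,1}`-semiregularity read on the obstruction group**: `E` is `{0,1}`-semiregular iff an
obstruction class `o ∈ Ext²(E, E ⊗ 𝒪_X)` with `σ₀(o) = 0` and `σ₁(o) = 0` vanishes.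
[cite: BuchweitzFlenner2003, §5 (I-semiregular)] -/
theorem isZeroOneSemiregular_iff_obstruction :
    IsZeroOneSemiregular hE ↔ ∀ o : obstructionGroup 2 E (unitModule X.left),
      sigmaZeroObstruction hE o = 0 → sigmaOneObstruction hE o = 0 → o = 0 := by
  rw [isZeroOneSemiregular_iff]
  constructor
  · intro h o h0 h1
    exact (obstructionGroupUnitEquiv E 2).map_eq_zero_iff.mp (h _ h0 h1)
  · intro h x h0 h1
    obtain ⟨o, rfl⟩ := (obstructionGroupUnitEquiv E 2).surjective x
    rw [h o h0 h1, map_zero]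

/-- `0`-semiregularity read on the obstruction group: `σ₀` is injective on `Ext²(E, E ⊗ 𝒪_X)`.
[cite: BuchweitzFlenner2003, §1 (k-semiregular)] -/
theorem isZeroSemiregular_iff_obstruction :
    IsZeroSemiregular hE ↔ Function.Injective (sigmaZeroObstruction hE) := by
  change Function.Injective _ ↔ Function.Injective (sigmaZero hE ∘ obstructionGroupUnitEquiv E 2)
  exact ⟨fun h => h.comp (obstructionGroupUnitEquiv E 2).injective,
    fun h => Function.Injective.of_comp_right h (obstructionGroupUnitEquiv E 2).surjective⟩

/-- `1`-semiregularity read on the obstruction group: `σ₁` is injective on `Ext²(E, E ⊗ 𝒪_X)`.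
[cite: BuchweitzFlenner2003, §1 (k-semiregular)] -/
theorem isOneSemiregular_iff_obstruction :
    IsOneSemiregular hE ↔ Function.Injective (sigmaOneObstruction hE) := by
  change Function.Injective _ ↔ Function.Injective (sigmaOne hE ∘ obstructionGroupUnitEquiv E 2)
  exact ⟨fun h => h.comp (obstructionGroupUnitEquiv E 2).injective,
    fun h => Function.Injective.of_comp_right h (obstructionGroupUnitEquiv E 2).surjective⟩

end Literature.AlgebraicGeometry.HodgeTheory

end
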